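import Summits.QuantumFields.YangMills.Theorems.WeakCouplingRatesRung
import Summits.QuantumFields.YangMills.Theorems.EquipartitionCriticalityCriticalContinuumLimitStubAdmissibleGivesGap
import HarnessLib

/-!
# Weak-coupling rates, calibration part 1/3: P3's SITE reflection versus the tree's BOND reflection; site-plane reflection positivity

NOT THE CLAY GAP.  Cell `ym-beyond`, seat P3 «lower the summit honestly» (HUMAN RULINGS D-0035 / D-0059 / D-0061; ladder rung R2ξ =
`WeakCouplingRates.XiPowSU2`, coordinator ruling 2026-08-25, caption «not the Clay direction; constraint on R2c schemes»).  The three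
calibration modules LINK the ladder's transfer-gap currency (`TorusClusteringAt` / `HasInfiniteVolumeGap` / `GapInUnits`, bond reflection
`gaugeTimeReflect`, OS reconstruction) to P3's RP-spectral currency (`HasRPTimeGap` / `MassGapUpperRateOf`, site reflection `timeReflectLG`), in
which XI-DIV is proved and the rung leaf XI-POW is stated.  This part is lattice geometry and reflection positivity only (`d = 4`):
* §A `gaugeTimeReflect_gaugeTimeShift : Θ (τ U) = θ U` and its companions — the two reflections differ by the unit time shift;
* §B `torus_rp_sitePlane` (odd tori) and `site_rp_of_oddTorusLimit` (odd-torus limit states): reflection positivity through the SITE plane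
  `x₀ = 0`, the time-`0` spatial links being shared, for cylinder observables supported at times `≥ 0` — from the shared-edge clause of the
  tree's `wilsonExpectation_oddReflectionPositive` via `AdmissibleGap.oddRP_reflected`; `rpCorr_zero_nonneg : 0 ≤ rpCorr μ F 0`.
References: K. Osterwalder, E. Seiler, Ann. Phys. 110 (1978) §2; J. Fröhlich, R. Israel, E. Lieb, B. Simon, Commun. Math. Phys. 62 (1978) §3
(site and bond reflections); E. Seiler, LNP 159 (1982) Ch. 2.
Filed for the cell by the courier seat `ym-beyond-courier` (prover filing rights, D-0016) from seat P3's HOME payload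
`LIFT-P3-WeakCouplingRatesCalibrationRP.lean` (sha16 ee68e98da9644dad); courier delta (no mathematics added, no statement changed): the
unused companion `measurable_timeReflectLG` was dropped on the gate's `dedup.landed` (normalised statement ≡ the landed
`Reconstructible.measurable_gaugeTimeReflect`); it is `measurable_gaugeTimeReflect.comp measurable_gaugeTimeShift` after `timeReflectLG_eq_comp`.
-/

set_option autoImplicit false

noncomputable section

open scoped BigOperators Topology ComplexConjugate ComplexOrder InnerProductSpace
open MeasureTheory Filter
open Literature.MathematicalPhysics Literature.MathematicalPhysics.QuantumFieldTheory
  Literature.MathematicalPhysics.QuantumLattice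
open Literature.Probability.LatticeModels (IsOSReconstructible IsBoundedMeasurable positiveEvents osForm
  TransferData)
open Summit.QuantumFields.YangMills.Theorems.ClusteringToYangMills.Reconstructible
open Summit.QuantumFields.YangMills.Theorems.CriticalContinuumLimit
open Summit.QuantumFields.YangMills.Theorems.CriticalContinuumLimit.AdmissibleGap

namespace Summit.QuantumFields.YangMills.Theorems.WeakCouplingRates

/-! ### §A. Geometry: P3's site reflection `θ = timeReflectLG` versus the tree's bond reflection `Θ = gaugeTimeReflect` -/

section Geometry

variable {G : Type} [Group G]

/-- **`Θ ∘ τ = θ`**: the bond reflection (plane `x₀ = -1/2`) of the unit-shifted configuration is the site reflection (plane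
`x₀ = 0`). [folklore] -/
theorem gaugeTimeReflect_gaugeTimeShift [MeasurableSpace G] (U : LGConfig 4 G) :
    gaugeTimeReflect (gaugeTimeShift U) = timeReflectLG U := by
  funext e
  rcases e with ⟨x, i⟩
  have hs1 : latticeTimeReflection 4 (x + Pi.single 0 1) + Pi.single 0 1 = trSite x - Pi.single 0 1 := by
    ext j
    by_cases hj : j = 0
    · subst hj; simp [trSite]; ring
    · simp [trSite, hj]
  have hs2 : latticeTimeReflection 4 x + Pi.single 0 1 = trSite x := by
    ext j
    by_cases hj : j = 0
    · subst hj; simp [trSite]; ring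
    · simp [trSite, hj]
  by_cases hi : i = 0
  · subst hi
    simp only [gaugeTimeReflect_apply, gaugeTimeShift_apply, timeReflectLG, if_true, hs1]
  · simp only [gaugeTimeReflect_apply, gaugeTimeShift_apply, timeReflectLG, hi, if_false, hs2]

/-- **`τ ∘ θ = Θ`**: the unit shift of the site-reflected configuration is the bond-reflected one. [folklore] -/
theorem gaugeTimeShift_timeReflectLG [MeasurableSpace G] (U : LGConfig 4 G) :
    gaugeTimeShift (timeReflectLG U) = gaugeTimeReflect U := by
  rw [← gaugeTimeReflect_gaugeTimeShift]
  exact gaugeTimeShift_gaugeTimeReflect_gaugeTimeShift U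

/-- `θ = Θ ∘ τ` as functions. [folklore] -/
theorem timeReflectLG_eq_comp [MeasurableSpace G] :
    (timeReflectLG : LGConfig 4 G → LGConfig 4 G) = gaugeTimeReflect ∘ gaugeTimeShift :=
  funext fun U => (gaugeTimeReflect_gaugeTimeShift U).symm

omit [Group G] in
/-- P3's time shift by one unit is the tree's `gaugeTimeShift`. [folklore] -/
theorem timeShiftLG_one_apply [MeasurableSpace G] (U : LGConfig 4 G) :
    timeShiftLG (G := G) 1 U = gaugeTimeShift U := by
  funext e
  simp [timeShiftLG, configShift_apply, gaugeTimeShift_apply, sub_neg_eq_add]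

/-- `θ` is continuous (`d = 4`). [folklore] -/
theorem continuous_timeReflectLG [TopologicalSpace G] [ContinuousInv G] [MeasurableSpace G] :
    Continuous (timeReflectLG : LGConfig 4 G → LGConfig 4 G) := by
  rw [timeReflectLG_eq_comp]
  exact continuous_gaugeTimeReflect.comp continuous_gaugeTimeShift

/-- A cylinder observable composed with `θ` is a cylinder observable (`d = 4`). [folklore] -/
theorem exists_isCylinder_comp_timeReflectLG [MeasurableSpace G] {α : Type*} {F : LGConfig 4 G → α}
    {Λ : Finset (QuantumLattice.ZdEdge 4)} (hF : IsCylinder F Λ) :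
    ∃ Λ' : Finset (QuantumLattice.ZdEdge 4), IsCylinder (fun U => F (timeReflectLG U)) Λ' := by
  have hfun : (fun U => F (timeReflectLG U)) = (F ∘ gaugeTimeReflect) ∘ gaugeTimeShift := by
    funext U; simp [gaugeTimeReflect_gaugeTimeShift]
  rw [hfun]
  exact ⟨_, isCylinder_comp_gaugeTimeShift (isCylinder_comp_gaugeTimeReflect hF)⟩

omit [Group G] in
/-- Products of cylinder observables are cylinder observables. [folklore] -/
theorem exists_isCylinder_mul {F₁ F₂ : LGConfig 4 G → ℝ} {Λ₁ Λ₂ : Finset (QuantumLattice.ZdEdge 4)}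
    (h₁ : IsCylinder F₁ Λ₁) (h₂ : IsCylinder F₂ Λ₂) :
    ∃ Λ' : Finset (QuantumLattice.ZdEdge 4), IsCylinder (fun U => F₁ U * F₂ U) Λ' :=
  ⟨Λ₁ ∪ Λ₂, isCylinder_map₂ (· * ·) h₁ h₂⟩

omit [Group G] in
/-- Constant shifts of cylinder observables are cylinder observables. [folklore] -/
theorem isCylinder_sub_const {F : LGConfig 4 G → ℝ} {Λ : Finset (QuantumLattice.ZdEdge 4)} (hF : IsCylinder F Λ) (c : ℝ) :
    IsCylinder (fun U => F U - c) Λ := fun U V hUV => by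
  simp only [hF hUV]

omit [Group G] in
/-- Linear combinations of cylinder observables are cylinder observables. [folklore] -/
theorem isCylinder_add_smul {F₁ F₂ : LGConfig 4 G → ℝ} {Λ₁ Λ₂ : Finset (QuantumLattice.ZdEdge 4)}
    (h₁ : IsCylinder F₁ Λ₁) (h₂ : IsCylinder F₂ Λ₂) (l : ℝ) :
    IsCylinder (fun U => F₁ U + l * F₂ U) (Λ₁ ∪ Λ₂) :=
  isCylinder_map₂ (fun a b => a + l * b) h₁ h₂

end Geometry

/-! ### §B. Reflection positivity through the SITE plane (shared in-plane links), on odd tori and for their limit states -/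

section SiteRP

variable {G : Type} [Group G] [TopologicalSpace G] [IsTopologicalGroup G] [CompactSpace G]
  [MeasurableSpace G] [BorelSpace G] {N : ℕ} (ρ : G →* Matrix (Fin N) (Fin N) ℂ) {S : ℕ}

omit [TopologicalSpace G] [IsTopologicalGroup G] [CompactSpace G] [BorelSpace G] in
/-- **The periodic lift intertwines the site reflections** after centring at the antipodal site plane `x₀ = S+1 ≡ -S` of the odd torus:
`θ (torusLift (T_{S e₀} W)) = torusLift (T_{S e₀} (Θ_T W))`. [folklore] -/
theorem timeReflectLG_torusLift_shift (W : GaugeConfig 4 (2 * S + 1) G) :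
    timeReflectLG (torusLift (2 * S + 1) (torusConfigShift (Pi.single 0 (S : ZMod (2 * S + 1))) W)) =
      torusLift (2 * S + 1) (torusConfigShift (Pi.single 0 (S : ZMod (2 * S + 1))) W.timeReflect) := by
  have hL0 := two_mul_S_add_one S
  rw [← gaugeTimeReflect_gaugeTimeShift, gaugeTimeShift_torusLift, torusConfigShift_torusConfigShift,
    ← Pi.single_add, gaugeTimeReflect_torusLift, timeReflect_torusConfigShift_single,
    torusConfigShift_torusConfigShift, ← Pi.single_add]
  have h : (-2 : ZMod (2 * S + 1)) + -(-1 + (S : ZMod (2 * S + 1))) = (S : ZMod (2 * S + 1)) := by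
    linear_combination -hL0
  rw [h]

omit [Group G] [TopologicalSpace G] [IsTopologicalGroup G] [CompactSpace G] [BorelSpace G] in
/-- **Site plane with shared links.** A cylinder observable supported on links based at times `0 ≤ x₀ ≤ S - 1`, lifted to the torus of
side `2S+1` and translated by `-S ≡ S+1` units (so that `ℤ⁴`-time `0` reads the antipodal site plane), depends only on links whose
`Θ_T`-reflections lie in the closed positive half — time-`0` SPATIAL links landing on the shared plane. [folklore] -/
theorem dependsOn_lift_shift_site {α : Type*} {F : LGConfig 4 G → α} {Λ : Finset (QuantumLattice.ZdEdge 4)}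
    (hF : IsCylinder F Λ) (hΛ : (↑Λ : Set (QuantumLattice.ZdEdge 4)) ⊆ posTimeEdges) (hS : maxTime Λ + 1 ≤ S) :
    DependsOn (fun W : GaugeConfig 4 (2 * S + 1) G =>
        F (torusLift (2 * S + 1) (torusConfigShift (Pi.single 0 (S : ZMod (2 * S + 1))) W)))
      {e : Edge 4 (2 * S + 1) | WilsonOddRP.IsOPosEdge (WilsonRP.edgeReflect e) ∨
        WilsonOddRP.IsOSharedEdge (WilsonRP.edgeReflect e)} := by
  intro U V hUV
  refine hF fun e he => ?_
  rw [torusLift_torusConfigShift_apply, torusLift_torusConfigShift_apply]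
  refine hUV _ ?_
  obtain ⟨n, hn, hnT⟩ := exists_nat_time_of_mem hΛ (Finset.mem_coe.1 he)
  set y : Site 4 (2 * S + 1) := Literature.Probability.LatticeModels.Torus.proj (2 * S + 1) e.1 -
    Pi.single 0 (S : ZMod (2 * S + 1)) with hy
  have hy0 : y 0 = (n : ZMod (2 * S + 1)) - (S : ZMod (2 * S + 1)) := by
    simp only [hy, Pi.sub_apply, Literature.Probability.LatticeModels.Torus.proj_apply, hn,
      Int.cast_natCast, Pi.single_eq_same]
  simp only [Set.mem_setOf_eq, WilsonOddRP.IsOPosEdge, WilsonOddRP.IsOSharedEdge]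
  unfold WilsonRP.edgeReflect
  by_cases hi : e.2 = 0
  · simp only [hi, ↓reduceIte]
    left
    have ht : (Site.shift y 0).timeReflect 0 = ((S - n : ℕ) : ZMod (2 * S + 1)) := by
      rw [WilsonRP.timeReflect_apply_zero, WilsonRP.shift_apply_self, hy0, Nat.cast_sub (by omega)]
      ring
    rw [ht, ZMod.val_natCast_of_lt (by omega)]
    omega
  · simp only [hi, ↓reduceIte]
    have ht : y.timeReflect 0 = ((S + 1 - n : ℕ) : ZMod (2 * S + 1)) := by
      rw [WilsonRP.timeReflect_apply_zero, hy0, Nat.cast_sub (by omega)]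
      push_cast
      ring
    by_cases hn0 : n = 0
    · right
      refine ⟨hi, ?_⟩
      rw [ht, ZMod.val_natCast_of_lt (by omega)]
      omega
    · left
      rw [ht, ZMod.val_natCast_of_lt (by omega)]
      omega

/-- **Site-plane reflection positivity for lifted observables (shared links allowed).** For a bounded measurable real cylinder
observable `F` of `ℤ⁴` supported on links based at times `0 ≤ x₀ ≤ S - 1` — INCLUDING the spatial links of the reflection plane
`x₀ = 0` — and `β ≥ 0`: `0 ≤ ∫ F(θ lift V) F(lift V) dμ_{2S+1,β}(V)` (FILS 1978 §3, reflection through sites; on the odd torus, the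
shared-edge clause of `wilsonExpectation_oddReflectionPositive`). [folklore] -/
theorem torus_rp_sitePlane (hρ : Continuous ρ) {β : ℝ} (hβ : 0 ≤ β) {F : LGConfig 4 G → ℝ}
    (hFm : Measurable F) (hFb : ∃ C : ℝ, ∀ U, |F U| ≤ C) {Λ : Finset (QuantumLattice.ZdEdge 4)} (hF : IsCylinder F Λ)
    (hΛ : (↑Λ : Set (QuantumLattice.ZdEdge 4)) ⊆ posTimeEdges) (hS : maxTime Λ + 1 ≤ S) :
    0 ≤ ∫ V, F (timeReflectLG (torusLift (2 * S + 1) V)) * F (torusLift (2 * S + 1) V)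
      ∂(wilsonMeasure (d := 4) (L := 2 * S + 1) ρ β) := by
  obtain ⟨C, hC⟩ := hFb
  set c : ZMod (2 * S + 1) := (S : ZMod (2 * S + 1)) with hc
  set F' : GaugeConfig 4 (2 * S + 1) G → ℂ := fun W =>
    ((F (torusLift (2 * S + 1) (torusConfigShift (Pi.single 0 c) W)) : ℝ) : ℂ) with hF'
  have hF'm : Measurable F' :=
    Complex.measurable_ofReal.comp (hFm.comp ((measurable_torusLift _).comp (torusConfigShift _).measurable))
  have hF'b : ∃ C : ℝ, ∀ W, ‖F' W‖ ≤ C :=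
    ⟨C, fun W => by rw [hF', Complex.norm_real, Real.norm_eq_abs]; exact hC _⟩
  have hFc : IsCylinder (fun U => ((F U : ℝ) : ℂ)) Λ := fun U V hUV => by simp only [hF hUV]
  have hdep := dependsOn_lift_shift_site (S := S) hFc hΛ hS
  have hpos := oddRP_reflected ρ ⟨S, by ring⟩ (by omega) hρ hβ F' hF'm hF'b hdep
  set g : GaugeConfig 4 (2 * S + 1) G → ℝ := fun V =>
    F (timeReflectLG (torusLift (2 * S + 1) V)) * F (torusLift (2 * S + 1) V) with hg
  have hint : (fun U : GaugeConfig 4 (2 * S + 1) G => conj (F' U.timeReflect) * F' U) =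
      (fun V => ((g V : ℝ) : ℂ)) ∘ torusConfigShift (Pi.single 0 c) := by
    funext U
    simp only [hF', hg, Function.comp_apply, Complex.conj_ofReal, ← Complex.ofReal_mul, hc,
      timeReflectLG_torusLift_shift]
  rw [hint, wilsonExpectation_comp_torusConfigShift] at hpos
  have hre : wilsonExpectation ρ β (fun V => ((g V : ℝ) : ℂ)) =
      ((∫ V, g V ∂(wilsonMeasure (d := 4) (L := 2 * S + 1) ρ β) : ℝ) : ℂ) := by
    simp only [wilsonExpectation]
    exact integral_complex_ofReal
  rw [hre] at hpos
  exact Complex.zero_le_real.1 hpos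

variable (r : LatticeRep G) {β : ℝ} {μ : Measure (LGConfig 4 G)}

/-- **Site-plane reflection positivity of odd-torus limit states** on continuous cylinder observables: for a bounded continuous real
cylinder `F` supported on links based at times `x₀ ≥ 0` (the time-`0` spatial links included), `0 ≤ ∫ F(θ U) F(U) dμ`. [folklore] -/
theorem site_rp_of_oddTorusLimit [SecondCountableTopology G] (hβ : 0 ≤ β) (hμ : μ ∈ oddTorusLimitPoints r β)
    {F : LGConfig 4 G → ℝ} (hFc : Continuous F) (hFb : ∃ C : ℝ, ∀ U, |F U| ≤ C) {Λ : Finset (QuantumLattice.ZdEdge 4)}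
    (hF : IsCylinder F Λ) (hΛ : (↑Λ : Set (QuantumLattice.ZdEdge 4)) ⊆ posTimeEdges) :
    0 ≤ ∫ U, F (timeReflectLG U) * F U ∂μ := by
  obtain ⟨C, hC⟩ := hFb
  obtain ⟨S, hS, -, hlim⟩ := hμ
  obtain ⟨Λ₁, hΛ₁⟩ := exists_isCylinder_comp_timeReflectLG (G := G) hF
  obtain ⟨Λ', hg⟩ := exists_isCylinder_mul hΛ₁ hF
  have hgc : Continuous fun U => F (timeReflectLG U) * F U :=
    (hFc.comp continuous_timeReflectLG).mul hFc
  have hgb : ∃ C' : ℝ, ∀ U, |F (timeReflectLG U) * F U| ≤ C' :=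
    ⟨C * C, fun U => by
      rw [abs_mul]
      exact mul_le_mul (hC _) (hC _) (abs_nonneg _) ((abs_nonneg (F U)).trans (hC U))⟩
  have ht := hlim (fun U => F (timeReflectLG U) * F U) Λ' hg hgc hgb
  refine ge_of_tendsto ht ?_
  filter_upwards [(hS.tendsto_atTop).eventually_ge_atTop (maxTime Λ + 1)] with k hk
  simp only [toTorusObservable, wilsonExpectation, Function.comp_apply]
  exact torus_rp_sitePlane r.ρ r.continuous hβ hFc.measurable ⟨C, hC⟩ hF hΛ hk

/-- The connected form of site-plane RP used below: `(∫ F∘θ dμ)(∫ F dμ) ≤ ∫ F(θ U) F(U) dμ`, i.e. `0 ≤ rpCorr μ F 0` — from RP for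
`F - c` with `c` the mean of the two means (no reflection invariance of `μ` is used). [folklore] -/
theorem rpCorr_zero_nonneg [SecondCountableTopology G] [IsProbabilityMeasure μ] (hβ : 0 ≤ β)
    (hμ : μ ∈ oddTorusLimitPoints r β) {F : LGConfig 4 G → ℝ} (hF : IsPosTimeObs F) :
    0 ≤ rpCorr μ F 0 := by
  obtain ⟨Λ, hFΛ, hΛ⟩ := hF.cyl
  obtain ⟨C, hC⟩ := hF.bdd
  have hΛ' : (↑Λ : Set (QuantumLattice.ZdEdge 4)) ⊆ posTimeEdges := fun e he => by
    simpa [mem_posTimeEdges] using hΛ e (Finset.mem_coe.1 he)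
  set a : ℝ := ∫ U, F (timeReflectLG U) ∂μ with ha
  set b : ℝ := ∫ U, F U ∂μ with hb
  set c : ℝ := (a + b) / 2 with hc
  -- RP for `F - c`
  have hrp := site_rp_of_oddTorusLimit r hβ hμ (F := fun U => F U - c) (hF.cont.sub continuous_const)
    ⟨C + |c|, fun U => by linarith [abs_sub (F U) c, hC U]⟩ (isCylinder_sub_const hFΛ c) hΛ'
  -- integrability of the pieces
  have hθc : Continuous fun U => F (timeReflectLG U) := hF.cont.comp continuous_timeReflectLG
  have hiθ : Integrable (fun U => F (timeReflectLG U)) μ :=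
    Integrable.of_bound hθc.measurable.aestronglyMeasurable C (ae_of_all _ fun U => by
      simpa [Real.norm_eq_abs] using hC (timeReflectLG U))
  have hiF : Integrable F μ :=
    Integrable.of_bound hF.cont.measurable.aestronglyMeasurable C (ae_of_all _ fun U => by
      simpa [Real.norm_eq_abs] using hC U)
  have hiprod : Integrable (fun U => F (timeReflectLG U) * F U) μ :=
    Integrable.of_bound (hθc.mul hF.cont).measurable.aestronglyMeasurable (C * C)
      (ae_of_all _ fun U => by
        rw [Real.norm_eq_abs, abs_mul]
        exact mul_le_mul (hC _) (hC _) (abs_nonneg _) ((abs_nonneg (F U)).trans (hC U)))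
  -- expand `∫ (F∘θ - c)(F - c) = ∫ F∘θ·F - c a - c b + c²`
  have hexp : ∫ U, (F (timeReflectLG U) - c) * (F U - c) ∂μ =
      (∫ U, F (timeReflectLG U) * F U ∂μ) - c * b - c * a + c * c := by
    have h1 : (fun U => (F (timeReflectLG U) - c) * (F U - c)) =
        fun U => F (timeReflectLG U) * F U - c * F U - c * F (timeReflectLG U) + c * c := by
      funext U; ring
    rw [h1, integral_add, integral_sub, integral_sub, integral_const_mul, integral_const_mul, integral_const]
    · simp [ha, hb]
    · exact hiprod
    · exact hiF.const_mul c
    · exact hiprod.sub (hiF.const_mul c)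
    · exact hiθ.const_mul c
    · exact (hiprod.sub (hiF.const_mul c)).sub (hiθ.const_mul c)
    · exact integrable_const _
  have hkey : c * b + c * a - c * c ≤ ∫ U, F (timeReflectLG U) * F U ∂μ := by
    have h0 : 0 ≤ ∫ U, (F (timeReflectLG U) - c) * (F U - c) ∂μ := by
      simpa [timeShiftLG_zero] using hrp
    linarith [hexp ▸ h0]
  have hamgm : a * b ≤ c * b + c * a - c * c := by
    rw [hc]; nlinarith [sq_nonneg (a - b)]
  simp only [rpCorr, timeShiftLG_zero]
  linarith

end SiteRP

end Summit.QuantumFields.YangMills.Theorems.WeakCouplingRates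

end
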